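import Literature.Geometry.Manifold.NaturalCohomologyEndo
import Literature.AlgebraicTopology.SingularHomology.BoundaryManifoldFiniteness
import HarnessLib

/-!
# Handlebodies of a compact manifold: injectivity, vanishing, finiteness and detection

For a compact `C^∞` manifold `M` without boundary charted on a real normed space `E` of dimension
`d + 1`, Morse theory (a nice Morse function `g` on `M` re-charted on `ℝᵈ⁺¹`, as in the tree's
`NaturalCohomologyEndo.app_eq_smul_of_pos`) provides an increasing sequence of open subsets
`U i = {g < cutLevel d (i + 1)}` — the handlebody of the handles of index `≤ i` — with:

* (inj)  `Hⁱ(M; F) → Hⁱ(U i; F)` injective (`Hᵢ(W_i) → Hᵢ(M)` is onto, Milnor 1965 Thm. 7.4, and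
  `{g < c} ≃ {g ≤ c}`, Milnor 1963 Thm. 3.1);
* (van)  `Hⱼ(U i; F) = 0` for `j > i` (no cells of dimension `> i`, Milnor 1963 Thm. 3.5);
* (fin)  `H_q(U i; F)` finite-dimensional for all `q` (`{g ≤ c}` is a compact manifold with
  boundary);
* (det)  for `1 ≤ i ≤ d + 1`, every non-zero `σ ∈ Hᵢ(U i; F)` is detected by the collapse map of
  some `i`-handle, `γ : U i → ℝⁱ ∪ {∞}`, `γ_* σ ≠ 0` (Milnor 1965, Cor. 3.15, Thm. 7.6).

This is `exists_handlebodies`. Everything is proved; no named facts.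

## References

* [Milnor1963] J. Milnor, *Morse Theory* (1963), Thm. 3.1, 3.5, §5.
* [MilnorHCobordism1965] J. Milnor, *Lectures on the h-cobordism theorem* (1965), Thm. 4.8, Cor. 3.15, Thm. 7.4, 7.6.
* [HatcherAT2002] A. Hatcher, *Algebraic Topology*, CUP 2002, §3.1 Thm. 3.2.
-/

noncomputable section

open scoped Manifold ContDiff Topology
open CategoryTheory Set Function Module
open Literature.AlgebraicTopology.SingularHomology Literature.Topology.FourManifolds
open Literature.Topology.FourManifolds.Cobordism (cutLevel)

namespace Literature.Geometry.Manifold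

variable {E : Type} [NormedAddCommGroup E] [NormedSpace ℝ E] [FiniteDimensional ℝ E] (F : Type) [Field F] {d : ℕ}

/-- A bijection from a module to a zero module forces the source to be zero. [folklore] -/
theorem isZero_of_injective_of_isZero {R : Type} [Ring R] {A B : ModuleCat.{0} R} (f : A →ₗ[R] B) (hf : Injective f)
    (hB : Limits.IsZero B) : Limits.IsZero A := by
  haveI := ModuleCat.subsingleton_of_isZero hB
  haveI : Subsingleton A := ⟨fun x y ↦ hf (Subsingleton.elim _ _)⟩
  exact ModuleCat.isZero_of_subsingleton A

/-- **Handlebodies of a compact manifold.** For a compact boundaryless `C^∞` manifold `M` charted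
on `E`, `dim E = d + 1`, there is an increasing sequence of open subsets `U i ⊆ M` such that
`Hⁱ(M; F) → Hⁱ(U i; F)` is injective, `Hⱼ(U i; F) = 0` for `j > i`, all `H_q(U i; F)` are
finite-dimensional, and for `1 ≤ i ≤ d + 1` every non-zero class of `Hᵢ(U i; F)` is detected by a
continuous map `U i → ℝⁱ ∪ {∞}` (the collapse of an `i`-handle).
[cite: Milnor1963, Thm. 3.1, Thm. 3.5] [cite: MilnorHCobordism1965, Cor. 3.15, Thm. 7.4, Thm. 7.6] -/
theorem exists_handlebodies (hd : Module.finrank ℝ E = d + 1) (M : Type) [TopologicalSpace M] [ChartedSpace E M]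
    [IsManifold 𝓘(ℝ, E) ∞ M] [T2Space M] [CompactSpace M] :
    ∃ U : ℕ → TopologicalSpace.Opens M,
      (∀ i j, i ≤ j → U i ≤ U j) ∧
      (∀ i, Injective (singularCohomology.map F F
        (⟨(Subtype.val : ↥(U i) → M), continuous_subtype_val⟩ : C(↥(U i), M)) i)) ∧
      (∀ i j, i < j → Limits.IsZero (singularHomology F F ↥(U i) j)) ∧
      (∀ i q, Module.Finite F (singularHomology F F ↥(U i) q)) ∧
      (∀ i, 1 ≤ i → i ≤ d + 1 → ∀ σ : singularHomology F F ↥(U i) i, σ ≠ 0 →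
        ∃ γ : C(↥(U i), OnePoint (EuclideanSpace ℝ (Fin i))), singularHomology.map F F γ i σ ≠ 0) := by
  classical
  -- ### re-charting `M` on `ℝᵈ⁺¹`
  let L : E ≃L[ℝ] EuclideanSpace ℝ (Fin (d + 1)) :=
    ContinuousLinearEquiv.ofFinrankEq (by rw [hd, finrank_euclideanSpace_fin])
  have hL : ContMDiff 𝓘(ℝ, E) 𝓘(ℝ, EuclideanSpace ℝ (Fin (d + 1))) ∞ L.toHomeomorph :=
    Rechart.contMDiff_of_apply_eq_linear (I := 𝓘(ℝ, E)) L.toHomeomorph L fun _ ↦ rfl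
  have hL' : ContMDiff 𝓘(ℝ, EuclideanSpace ℝ (Fin (d + 1))) 𝓘(ℝ, E) ∞ L.toHomeomorph.symm :=
    Rechart.contMDiff_symm_of_apply_eq_linear (I := 𝓘(ℝ, E)) L.toHomeomorph L fun _ ↦ rfl
  haveI : IsManifold (𝓡 (d + 1)) ∞ (Rechart L.toHomeomorph M) := Rechart.isManifold _ M hL hL'
  haveI : SecondCountableTopology M := ChartedSpace.secondCountable_of_sigmaCompact E M
  haveI : SecondCountableTopology (Rechart L.toHomeomorph M) := ‹SecondCountableTopology M›
  -- ### a nice Morse function and a gradient-like vector field on `(X; ∅, ∅)`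
  obtain ⟨f₀, hf₀⟩ := exists_isMorse_holds (d + 1) (Rechart L.toHomeomorph M)
  obtain ⟨f₁, hf₁, hsi, -, -⟩ :=
    exists_isSelfIndexing_criticalSet_eq_holds (d + 1) (Rechart L.toHomeomorph M) f₀ hf₀
  obtain ⟨g, hg⟩ : ∃ g : (Cobordism.ofClosed d (Rechart L.toHomeomorph M)).W → ℝ,
      (Cobordism.ofClosed d (Rechart L.toHomeomorph M)).IsNiceMorseFunction g :=
    ⟨_, (IsSelfIndexing.isNiceMorseFunction_ofClosed hf₁ hsi).1⟩
  obtain ⟨ξ, hξ⟩ := Cobordism.Milnor1965_exists_isGradientLike_holds hg.isMorseFunction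
  have hgM := hg.isMorseFunction
  have hgc : Continuous g := hgM.isMorse.contMDiff.continuous
  -- `g` read on `X`, regularity of the cut levels
  let f : Rechart L.toHomeomorph M → ℝ := fun y ↦ g (HalfSpaceCharted.of y)
  have hfg : f ∘ ⇑HalfSpaceCharted.of.symm = g := rfl
  have hfM : IsMorse (𝓡 (d + 1)) f := HalfSpaceCharted.isMorse_iff.1 (hfg ▸ hgM.isMorse)
  have hfs : ContMDiff (𝓡 (d + 1)) 𝓘(ℝ, ℝ) ∞ f := hfM.contMDiff
  have hfc : Continuous f := hfs.continuous
  have hcritf : ∀ y, IsMCriticalPt (𝓡 (d + 1)) f y →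
      HalfSpaceCharted.of y ∈ criticalSet (𝓡∂ (d + 1)) g :=
    fun y hy ↦ (HalfSpaceCharted.isMCriticalPt_iff' (f := f) (q := HalfSpaceCharted.of y)).2 hy
  have hregb : ∀ (i : ℕ) (y), f y = cutLevel d (i + 1) → mfderiv (𝓡 (d + 1)) 𝓘(ℝ, ℝ) f y ≠ 0 := by
    intro i y hy hd'
    exact hg.apply_ne_cutLevel (hcritf y hd') (i + 1) hy
  have hne : ∀ (i : ℕ), ∀ z ∈ criticalSet (𝓡 (d + 1)) f, f z ≠ cutLevel d (i + 1) :=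
    fun i z hz ↦ hg.apply_ne_cutLevel (hcritf z hz) (i + 1)
  have hcpt : ∀ i : ℕ, IsCompact (f ⁻¹' Iic (cutLevel d (i + 1))) :=
    fun i ↦ (isClosed_Iic.preimage hfc).isCompact
  -- ### the handlebodies
  let τ : M ≃ₜ (Cobordism.ofClosed d (Rechart L.toHomeomorph M)).W := NaturalCohomologyEndo.toW d L.toHomeomorph M
  let U : ℕ → TopologicalSpace.Opens M := fun i ↦ NaturalCohomologyEndo.sublevelOpens τ hgc (cutLevel d (i + 1))
  -- `{g < c} → {g ≤ c}` is a homology isomorphism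
  have hbij : ∀ (i q : ℕ), Bijective (singularHomology.map F F
      (⟨fun x ↦ ⟨x.1, le_of_lt x.2⟩, continuous_subtype_val.subtype_mk _⟩ :
        C({x : Rechart L.toHomeomorph M // f x < cutLevel d (i + 1)},
          {x : Rechart L.toHomeomorph M // f x ≤ cutLevel d (i + 1)})) q) :=
    fun i q ↦ bijective_map_inclusion_sublevel_lt F F hfs (hregb i) q
  refine ⟨U, ?_, ?_, ?_, ?_, ?_⟩
  · -- ### monotonicity
    intro i j hij x hx
    exact lt_of_lt_of_le hx (Cobordism.cutLevel_mono d (by omega))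
  · -- ### (inj) `Hⁱ(M) → Hⁱ(U i)` is injective: `Hᵢ(U i) ≅ Hᵢ(W_i) → Hᵢ(M)` is onto
    intro i
    have hsurjW : Surjective (singularHomology.map F F
        (subsetIncl {z : (Cobordism.ofClosed d (Rechart L.toHomeomorph M)).W |
          g z < cutLevel d (i + 1)}) i) := by
      have h1 := hg.surjective_map_subsetIncl_cutLevel F F i
      have h2 := hbij i i
      have hcomp : subsetIncl {z : (Cobordism.ofClosed d (Rechart L.toHomeomorph M)).W |
            g z < cutLevel d (i + 1)} =
          (subsetIncl {z : (Cobordism.ofClosed d (Rechart L.toHomeomorph M)).W |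
            g z ≤ cutLevel d (i + 1)}).comp
            ⟨fun u ↦ ⟨u.1, (show g u.1 < cutLevel d (i + 1) from u.2).le⟩,
              continuous_subtype_val.subtype_mk _⟩ := rfl
      rw [hcomp, singularHomology.map_comp]
      intro z
      obtain ⟨y, hy⟩ := h1 z
      obtain ⟨w, hw⟩ := h2.2 y
      refine ⟨w, ?_⟩
      rw [ModuleCat.comp_apply]
      exact (congrArg (singularHomology.map F F (subsetIncl
        {z : (Cobordism.ofClosed d (Rechart L.toHomeomorph M)).W | g z ≤ cutLevel d (i + 1)}) i) hw).trans hy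
    rw [singularCohomology_map_injective_iff_of_field]
    exact hsurjW
  · -- ### (van) `Hⱼ(U i) = 0` for `j > i`
    intro i j hij
    have hZ : Limits.IsZero (singularHomology F F ↥(f ⁻¹' Iic (cutLevel d (i + 1))) j) := by
      refine hfM.isZero_singularHomology_sublevel (R := F) (M₀ := F) (hne i) (hcpt i) fun z hz hzle hidx ↦ ?_
      have hz' : HalfSpaceCharted.of z ∈ criticalSet (𝓡∂ (d + 1)) g := hcritf z hz
      have hlt : g (HalfSpaceCharted.of z) < Cobordism.plusLevel d i := by
        rw [← Cobordism.cutLevel_succ]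
        exact lt_of_le_of_ne hzle (hg.apply_ne_cutLevel hz' (i + 1))
      have hle := hg.morseIndex_le_of_apply_lt_plusLevel hz' hlt
      have heq : morseIndex (𝓡∂ (d + 1)) g (HalfSpaceCharted.of z) = morseIndex (𝓡 (d + 1)) f z :=
        HalfSpaceCharted.morseIndex_eq' (f := f) ((hfs z).of_le (by norm_cast)) hz
      have hle' : morseIndex (𝓡 (d + 1)) f z ≤ i := heq.symm.trans_le hle
      rw [hidx] at hle'
      omega
    exact isZero_of_injective_of_isZero (singularHomology.map F F _ j).hom (hbij i j).1 hZ
  · -- ### (fin) `H_q(U i)` is finite-dimensional: `{g ≤ c}` is a compact manifold with boundary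
    intro i q
    have hreg : IsRegularLevel (𝓡 (d + 1)) f (cutLevel d (i + 1)) := hfM.isRegularLevel fun z hz ↦ hne i z hz
    haveI : CompactSpace (RegularSublevel hreg) := isCompact_iff_compactSpace.1 (hcpt i)
    have hfin : Module.Finite F (singularHomology F F (RegularSublevel hreg) q) :=
      finite_singularHomology_of_compact_chartedSpace_halfSpace (R := F) (M := F) (n := d) (W := RegularSublevel hreg) q
    haveI : Module.Finite F (singularHomology F F {x : Rechart L.toHomeomorph M // f x ≤ cutLevel d (i + 1)} q) := hfin
    haveI : IsNoetherian F (singularHomology F F {x : Rechart L.toHomeomorph M // f x ≤ cutLevel d (i + 1)} q) :=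
      isNoetherian_of_isNoetherianRing_of_finite F _
    exact Module.Finite.of_injective (singularHomology.map F F _ q).hom (hbij i q).1
  · -- ### (det) detection by the collapse maps of the `i`-handles
    intro i hi1 hid σ hσ0
    let Δ : ∀ p : ↥(criticalSetOfIndex (𝓡∂ (d + 1)) g i),
        Cobordism.DetectionDatum (Cobordism.ofClosed d (Rechart L.toHomeomorph M)) g (⇑ξ) i p :=
      fun p ↦ Classical.choice (hg.nonempty_detectionDatum ξ hξ hid p.2)
    obtain ⟨p, hp⟩ := hg.exists_map_collapse_ne_zero F ξ hξ hi1 hid Δ σ hσ0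
    exact ⟨⟨fun u ↦ (Δ p).map u, (Δ p).map.continuous⟩, hp⟩

end Literature.Geometry.Manifold
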